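import Literature.Analysis.FluidPDE.FractalHomogenizationLackOfSelection
import Literature.Analysis.FluidPDE.RenormalizedDiffusivityCascadeScales
import Literature.Analysis.FunctionSpaces.TorusScalarTrigPoly
import Literature.Analysis.FunctionSpaces.TorusSobolevNormSmoothProofs
import HarnessLib

/-!
# Armstrong–Vicol, Prop. 5.5 (lack of selection): the data class is inhabited — proofs

Companion of `FractalHomogenizationLackOfSelection.lean` (Armstrong–Vicol, Ann. PDE **11** (2025) =
arXiv:2305.05048v3, §5.5 Prop. 5.5 p. 93, typed there as the named fact `ArmstrongVicol2025_prop55`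
over the data class `ArmstrongVicol2025.InSelectionClass β C⋆ A B Λ` of (5.139)–(5.140) p. 99).
Everything here is PROVED (no new facts):

* the cosine datum `θ_k = Re(½e_k + ½e_{-k}) = cos(2π k·x)` (`FunctionSpaces.Torus.reTrigPoly {k,-k} ½`),
  `k ≠ 0`: smooth, mean zero, `‖θ_k‖²_{L²} = ½`, `‖∇θ_k‖²_{L²} = 2π²|k|²`, `‖Δθ_k‖²_{L²} = 8π⁴|k|⁴`
  (spectral `Torus.eScalarGradNormSq`, `Torus.eScalarLaplacianNormSq`), hence it saturates (5.139)
  (`‖∇θ₀‖⁴ = ‖θ₀‖² ‖Δθ₀‖²`, a Laplace eigenfunction) and has length scale `L = 1/(2π|k|)`;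
* `ArmstrongVicol2025.selectionExponent_pos`: `2 + γ - 2qδ > 0`, i.e. the printed exponent
  `2/(2+γ-2qδ)` is positive, for `β ∈ [68/67, 4/3)` (p. 98: "they satisfy `2 + γ - 2qδ > 0` for all
  `β ∈ (1, 4/3)`"; here from `q = q(β) ≤ 17` and (2.5) in the form (2.3));
* `ArmstrongVicol2025.exists_inSelectionClass`: for every `β` with `1 < q(β)` and positive exponent,
  every `C⋆ > 0`, `A ≤ 1`, `B > 1` and every minimal scale separation `Λ ≥ 3`, some axis mode
  `cos(2π j x_{i₀})`, `j ≥ 1`, lies in `InSelectionClass β C⋆ A B Λ` — the window (5.140) is met because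
  the admissible length scales `C⋆ (2πj)^{-p}` have consecutive ratios `→ 1` while the windows
  `[εₘ, min(B,2) εₘ]` have ratio `> 1` and `εₘ → 0` ((2.9): `εₘ ≤ Λ^{-m}`);
  AV p. 93: "Our result applies to a large class of `Ḣ²(T²)` initial conditions";
* `ArmstrongVicol2025.exists_lacksSelectionAt_of_prop55`: consequently Prop. 5.5 is not vacuous — for
  every `β ∈ [68/67, 4/3)` the Armstrong–Vicol carrier (Thm. 1.1 class, dissipating all `H¹` data along
  its intervals) admits an explicit smooth mean-zero datum whose vanishing-diffusivity limits do not
  select (two null sequences of diffusivities, two distinct `C([0,1];L²)` weak transport solutions),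
  the existential "lack of selection" shape of Colombo–Crippa–Sorella's Thm. B
  (`ColomboCrippaSorella2023_thmB`) for the fractal-homogenisation field.

## References

* S. Armstrong, V. Vicol, *Anomalous diffusion by fractal homogenization*, Ann. PDE 11 (2025) =
  arXiv:2305.05048v3, §2.1 (2.2)–(2.10) pp. 18–19, §5.5 Prop. 5.5 p. 93, (5.133)–(5.140) pp. 98–99.
* L. Grafakos, *Classical Fourier Analysis*, 3rd ed. (2014), §3.1.1, Prop. 3.2.7 (Parseval on `T^d`).
-/

open MeasureTheory Set Filter Topology UnitAddTorus
open scoped ENNReal NNReal ComplexConjugate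

namespace Literature.Analysis.FluidPDE

noncomputable section

namespace ArmstrongVicol2025

variable {d : Type*} [Fintype d]

/-! ## The cosine datum `Re(½e_k + ½e_{-k})` -/

section CosMode

omit [Fintype d] in
/-- `k ≠ 0` in `ℤ^d` implies `k ≠ -k`. [folklore] -/
private theorem ne_neg_self_of_ne_zero {k : d → ℤ} (hk : k ≠ 0) : k ≠ -k := by
  intro h
  apply hk
  funext i
  have hi := congr_fun h i
  simp only [Pi.neg_apply] at hi
  simp only [Pi.zero_apply]
  omega

/-- The frequency pair `{k, -k}` is symmetric. [folklore] -/
private theorem neg_mem_pair (k : d → ℤ) :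
    ∀ l ∈ ({k, -k} : Finset (d → ℤ)), -l ∈ ({k, -k} : Finset (d → ℤ)) := by
  intro l hl
  simp only [Finset.mem_insert, Finset.mem_singleton] at hl ⊢
  rcases hl with rfl | rfl
  · exact Or.inr rfl
  · exact Or.inl (neg_neg _)

omit [Fintype d] in
/-- The constant real coefficient family `½` is conjugate symmetric. [folklore] -/
private theorem isConjSymmScalar_const_half :
    FunctionSpaces.Torus.IsConjSymmScalar (fun _ : d → ℤ => (((1 / 2 : ℝ)) : ℂ)) :=
  fun _ => (Complex.conj_ofReal _).symm

/-- The Fourier coefficients of the cosine datum: `½` on `{k, -k}`, `0` elsewhere.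
[cite: Grafakos2014, §3.1.1] -/
theorem mFourierCoeff_cosMode (k l : d → ℤ) :
    mFourierCoeff
        (fun x => ((FunctionSpaces.Torus.reTrigPoly {k, -k} (fun _ => (((1 / 2 : ℝ)) : ℂ)) x : ℝ) : ℂ)) l =
      if l ∈ ({k, -k} : Finset (d → ℤ)) then (((1 / 2 : ℝ)) : ℂ) else 0 :=
  FunctionSpaces.Torus.mFourierCoeff_ofReal_reTrigPoly (neg_mem_pair k) isConjSymmScalar_const_half l

/-- The cosine datum (a real trigonometric polynomial) is smooth. [cite: Grafakos2014, §3.1.1] -/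
theorem isSmooth_cosMode (k : d → ℤ) :
    FunctionSpaces.Torus.IsSmooth
      (FunctionSpaces.Torus.reTrigPoly {k, -k} (fun _ => (((1 / 2 : ℝ)) : ℂ))) :=
  FunctionSpaces.Torus.isSmooth_reTrigPoly _ _

/-- The cosine datum lies in every `H^s` (viewed in `ℂ`; a trigonometric polynomial). [cite: Grafakos2014, §3.1.1 and §3.3] -/
theorem memSobolev_cosMode (k : d → ℤ) (s : ℝ) :
    FunctionSpaces.Torus.MemSobolev s
      (fun x => ((FunctionSpaces.Torus.reTrigPoly {k, -k} (fun _ => (((1 / 2 : ℝ)) : ℂ)) x : ℝ) : ℂ)) := by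
  have h : (fun x =>
      ((FunctionSpaces.Torus.reTrigPoly {k, -k} (fun _ => (((1 / 2 : ℝ)) : ℂ)) x : ℝ) : ℂ)) =
      FunctionSpaces.Torus.trigPoly {k, -k} (fun _ => (((1 / 2 : ℝ)) : ℂ)) :=
    funext (FunctionSpaces.Torus.ofReal_reTrigPoly (neg_mem_pair k) isConjSymmScalar_const_half)
  rw [h]
  exact FunctionSpaces.Torus.IsSmooth.memSobolev_holds (FunctionSpaces.Torus.isSmooth_trigPoly _ _) s

/-- `‖cos(2πk·x)‖²_{L²} = ½` for `k ≠ 0`. [cite: Grafakos2014, Prop. 3.2.7 (3)] -/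
theorem scalarL2Sq_cosMode {k : d → ℤ} (hk : k ≠ 0) :
    Torus.scalarL2Sq (FunctionSpaces.Torus.reTrigPoly {k, -k} (fun _ => (((1 / 2 : ℝ)) : ℂ))) = 1 / 2 := by
  have h := FunctionSpaces.Torus.integral_sq_reTrigPoly (neg_mem_pair k)
    (isConjSymmScalar_const_half (d := d))
  rw [Finset.sum_pair (ne_neg_self_of_ne_zero hk), Complex.norm_real,
    Real.norm_of_nonneg (by norm_num : (0 : ℝ) ≤ 1 / 2)] at h
  rw [Torus.scalarL2Sq, h]
  norm_num

/-- The cosine datum has zero mean (`k ≠ 0`: its zeroth Fourier coefficient vanishes). [cite: Grafakos2014, §3.1.1] -/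
theorem hasZeroMean_cosMode {k : d → ℤ} (hk : k ≠ 0) :
    FunctionSpaces.Torus.HasZeroMean
      (FunctionSpaces.Torus.reTrigPoly {k, -k} (fun _ => (((1 / 2 : ℝ)) : ℂ))) := by
  have h0 : (0 : d → ℤ) ∉ ({k, -k} : Finset (d → ℤ)) := by
    simp only [Finset.mem_insert, Finset.mem_singleton, not_or]
    exact ⟨fun h => hk h.symm, fun h => hk (neg_eq_zero.mp h.symm)⟩
  have hc := mFourierCoeff_cosMode k 0
  rw [if_neg h0, FunctionSpaces.Torus.mFourierCoeff_eq_integral_volume] at hc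
  have hint : (∫ x, mFourier (-0 : d → ℤ) x •
      ((FunctionSpaces.Torus.reTrigPoly {k, -k} (fun _ => (((1 / 2 : ℝ)) : ℂ)) x : ℝ) : ℂ)) =
      ∫ x, ((FunctionSpaces.Torus.reTrigPoly {k, -k} (fun _ => (((1 / 2 : ℝ)) : ℂ)) x : ℝ) : ℂ) := by
    refine integral_congr_ae (Eventually.of_forall fun x => ?_)
    simp only [neg_zero, mFourier_zero, ContinuousMap.one_apply, one_smul]
  rw [hint, integral_complex_ofReal, Complex.ofReal_eq_zero] at hc
  exact hc

omit [Fintype d] in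
/-- `(y^{1/2})² = y` in `[0, ∞]`. [folklore] -/
private theorem rpow_half_sq' (y : ℝ≥0∞) : (y ^ (1 / 2 : ℝ)) ^ 2 = y := by
  rw [← ENNReal.rpow_natCast, ← ENNReal.rpow_mul]
  norm_num

/-- The weighted spectral sums of the cosine datum: `∑_{l≠0} |l|^{2s} |θ̂(l)|² = |k|^{2s}/2`
(`k ≠ 0`). [cite: Grafakos2014, §3.1.1] -/
theorem eHomSobolevSeminorm_cosMode_sq {k : d → ℤ} (hk : k ≠ 0) (s : ℝ) :
    FunctionSpaces.Torus.eHomSobolevSeminorm s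
        (fun x => ((FunctionSpaces.Torus.reTrigPoly {k, -k} (fun _ => (((1 / 2 : ℝ)) : ℂ)) x : ℝ) : ℂ)) ^ 2 =
      ENNReal.ofReal (FunctionSpaces.Torus.freqNormSq k ^ s / 2) := by
  rw [FunctionSpaces.Torus.eHomSobolevSeminorm, rpow_half_sq']
  -- the summand
  set F : (d → ℤ) → ℝ≥0∞ := fun l =>
    (if l = 0 then 0 else ENNReal.ofReal (FunctionSpaces.Torus.freqNormSq l ^ s)) *
      ‖mFourierCoeff
        (fun x => ((FunctionSpaces.Torus.reTrigPoly {k, -k} (fun _ => (((1 / 2 : ℝ)) : ℂ)) x : ℝ) : ℂ))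
          l‖ₑ ^ 2 with hF
  have hsupp : ∀ l ∉ ({k, -k} : Finset (d → ℤ)), F l = 0 := by
    intro l hl
    simp only [hF, mFourierCoeff_cosMode, if_neg hl, enorm_zero, ne_eq, OfNat.ofNat_ne_zero,
      not_false_eq_true, zero_pow, mul_zero]
  have hhalf : ‖(((1 / 2 : ℝ)) : ℂ)‖ₑ ^ 2 = ENNReal.ofReal (1 / 4) := by
    rw [← ofReal_norm, Complex.norm_real, Real.norm_of_nonneg (by norm_num : (0 : ℝ) ≤ 1 / 2),
      ← ENNReal.ofReal_pow (by norm_num : (0 : ℝ) ≤ 1 / 2)]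
    norm_num
  have hval : ∀ l ∈ ({k, -k} : Finset (d → ℤ)),
      F l = ENNReal.ofReal (FunctionSpaces.Torus.freqNormSq k ^ s / 4) := by
    intro l hl
    have hl0 : l ≠ 0 := by
      simp only [Finset.mem_insert, Finset.mem_singleton] at hl
      rcases hl with rfl | rfl
      · exact hk
      · exact fun h => hk (neg_eq_zero.mp h)
    have hn : FunctionSpaces.Torus.freqNormSq l = FunctionSpaces.Torus.freqNormSq k := by
      simp only [Finset.mem_insert, Finset.mem_singleton] at hl
      rcases hl with rfl | rfl
      · rfl
      · exact FunctionSpaces.Torus.freqNormSq_neg _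
    simp only [hF, mFourierCoeff_cosMode, if_pos hl, if_neg hl0, hhalf, hn]
    rw [← ENNReal.ofReal_mul (Real.rpow_nonneg (FunctionSpaces.Torus.freqNormSq_nonneg k) s)]
    congr 1
    ring
  have hq : 0 ≤ FunctionSpaces.Torus.freqNormSq k ^ s / 4 :=
    div_nonneg (Real.rpow_nonneg (FunctionSpaces.Torus.freqNormSq_nonneg k) s) (by norm_num)
  rw [tsum_eq_sum (s := ({k, -k} : Finset (d → ℤ))) (fun l hl => hsupp l hl),
    Finset.sum_pair (ne_neg_self_of_ne_zero hk), hval k (by simp), hval (-k) (by simp),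
    ← ENNReal.ofReal_add hq hq]
  congr 1
  ring

/-- `‖∇cos(2πk·x)‖²_{L²} = 2π²|k|²` (spectral form, `k ≠ 0`). [cite: Grafakos2014, Prop. 3.2.6 (8)] -/
theorem eScalarGradNormSq_cosMode {k : d → ℤ} (hk : k ≠ 0) :
    Torus.eScalarGradNormSq (FunctionSpaces.Torus.reTrigPoly {k, -k} (fun _ => (((1 / 2 : ℝ)) : ℂ))) =
      ENNReal.ofReal (2 * Real.pi ^ 2 * FunctionSpaces.Torus.freqNormSq k) := by
  rw [Torus.eScalarGradNormSq, eHomSobolevSeminorm_cosMode_sq hk, Real.rpow_one,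
    ← ENNReal.ofReal_mul (by positivity)]
  congr 1
  ring

/-- `‖Δcos(2πk·x)‖²_{L²} = 8π⁴|k|⁴` (spectral form, `k ≠ 0`). [cite: Grafakos2014, Prop. 3.2.6 (8)] -/
theorem eScalarLaplacianNormSq_cosMode {k : d → ℤ} (hk : k ≠ 0) :
    Torus.eScalarLaplacianNormSq
        (FunctionSpaces.Torus.reTrigPoly {k, -k} (fun _ => (((1 / 2 : ℝ)) : ℂ))) =
      ENNReal.ofReal (8 * Real.pi ^ 4 * FunctionSpaces.Torus.freqNormSq k ^ 2) := by
  rw [Torus.eScalarLaplacianNormSq, eHomSobolevSeminorm_cosMode_sq hk,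
    show (2 : ℝ) = ((2 : ℕ) : ℝ) by norm_num, Real.rpow_natCast,
    ← ENNReal.ofReal_mul (by positivity)]
  congr 1
  ring

/-- **The cosine datum saturates (5.139)**: `A ‖θ‖² ‖Δθ‖² ≤ (‖∇θ‖²)²` for every `A ≤ 1`
(with equality at `A = 1`: a Laplace eigenfunction). [cite: ArmstrongVicol2025, (5.139) p. 99] -/
theorem cond5139_cosMode {k : d → ℤ} (hk : k ≠ 0) {A : ℝ} (hA : A ≤ 1) :
    ENNReal.ofReal A *
        (ENNReal.ofReal (Torus.scalarL2Sq
            (FunctionSpaces.Torus.reTrigPoly {k, -k} (fun _ => (((1 / 2 : ℝ)) : ℂ)))) *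
          Torus.eScalarLaplacianNormSq
            (FunctionSpaces.Torus.reTrigPoly {k, -k} (fun _ => (((1 / 2 : ℝ)) : ℂ)))) ≤
      Torus.eScalarGradNormSq
          (FunctionSpaces.Torus.reTrigPoly {k, -k} (fun _ => (((1 / 2 : ℝ)) : ℂ))) ^ 2 := by
  have hn := FunctionSpaces.Torus.freqNormSq_nonneg k
  have h2 : (0 : ℝ) ≤ 2 * Real.pi ^ 2 * FunctionSpaces.Torus.freqNormSq k := by positivity
  rw [scalarL2Sq_cosMode hk, eScalarLaplacianNormSq_cosMode hk, eScalarGradNormSq_cosMode hk,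
    ← ENNReal.ofReal_mul (by norm_num), ← ENNReal.ofReal_pow h2]
  rcases le_or_gt A 0 with hA0 | hA0
  · rw [ENNReal.ofReal_of_nonpos hA0, zero_mul]
    exact bot_le
  · rw [← ENNReal.ofReal_mul hA0.le]
    apply ENNReal.ofReal_le_ofReal
    have h4 : 0 ≤ Real.pi ^ 4 * FunctionSpaces.Torus.freqNormSq k ^ 2 := by positivity
    nlinarith

/-- **The length scale of the cosine datum**: `‖θ‖²_{L²} = ℓ² ‖∇θ‖²_{L²}` whenever
`ℓ² · 4π²|k|² = 1` (`k ≠ 0`; `ℓ = 1/(2π|k|)`).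
[cite: ArmstrongVicol2025, Prop. 5.5 p. 93 (the length scale `L_{θ₀}`)] -/
theorem lengthScale_cosMode {k : d → ℤ} (hk : k ≠ 0) {ℓ : ℝ}
    (hℓ : ℓ ^ 2 * (4 * Real.pi ^ 2 * FunctionSpaces.Torus.freqNormSq k) = 1) :
    ENNReal.ofReal (Torus.scalarL2Sq
        (FunctionSpaces.Torus.reTrigPoly {k, -k} (fun _ => (((1 / 2 : ℝ)) : ℂ)))) =
      ENNReal.ofReal (ℓ ^ 2) *
        Torus.eScalarGradNormSq
          (FunctionSpaces.Torus.reTrigPoly {k, -k} (fun _ => (((1 / 2 : ℝ)) : ℂ))) := by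
  rw [scalarL2Sq_cosMode hk, eScalarGradNormSq_cosMode hk, ← ENNReal.ofReal_mul (sq_nonneg _)]
  congr 1
  linear_combination (-1 / 2 : ℝ) * hℓ

end CosMode

/-! ## A lattice point in a multiplicative window -/

section Window

/-- **Length scales `C (2πj)^{-p}` hit every small multiplicative window**: for `p, C > 0`, `R > 1`
and a positive null sequence `εₘ`, some `m ≥ 1` and `j ≥ 1` satisfy
`εₘ ≤ C (2πj)^{-p} ≤ R εₘ` (consecutive ratios `(j/(j+1))^p → 1` versus window ratio `R > 1`).
Elementary; the step that makes Prop. 5.5's window (5.140) attainable by Laplace eigen-data.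
[cite: ArmstrongVicol2025, (5.140) p. 99 ("it is the upper bound in (5.140) which is the assumption")] -/
theorem exists_lengthScale_window {p C R : ℝ} (hp : 0 < p) (hC : 0 < C) (hR : 1 < R)
    {ε : ℕ → ℝ} (hε : ∀ m, 0 < ε m) (hε0 : Tendsto ε atTop (𝓝 0)) :
    ∃ m : ℕ, 1 ≤ m ∧ ∃ j : ℕ, 1 ≤ j ∧
      ε m ≤ C / (2 * Real.pi * j) ^ p ∧ C / (2 * Real.pi * j) ^ p ≤ R * ε m := by
  classical
  -- the admissible length scales `v j = C (2πj)^{-p}`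
  set v : ℕ → ℝ := fun j => C / (2 * Real.pi * j) ^ p with hv
  have hbase : ∀ j : ℕ, 1 ≤ j → 0 < 2 * Real.pi * (j : ℝ) := fun j hj => by
    have : (1 : ℝ) ≤ j := by exact_mod_cast hj
    positivity
  have hvpos : ∀ j : ℕ, 1 ≤ j → 0 < v j := fun j hj =>
    div_pos hC (Real.rpow_pos_of_pos (hbase j hj) p)
  -- consecutive ratios: `v (j+1) = v j · (j/(j+1))^p`
  have hsucc : ∀ j : ℕ, 1 ≤ j → v (j + 1) = v j * ((j : ℝ) / (j + 1)) ^ p := by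
    intro j hj
    have hj0 : (0 : ℝ) < j := by exact_mod_cast hj
    have hj1 : (0 : ℝ) < (j : ℝ) + 1 := by positivity
    have h2pi : (0 : ℝ) < 2 * Real.pi := by positivity
    simp only [hv, Nat.cast_add, Nat.cast_one]
    rw [Real.div_rpow hj0.le hj1.le, Real.mul_rpow h2pi.le hj0.le, Real.mul_rpow h2pi.le hj1.le]
    have hjp : (0 : ℝ) < (j : ℝ) ^ p := Real.rpow_pos_of_pos hj0 p
    have hj1p : (0 : ℝ) < ((j : ℝ) + 1) ^ p := Real.rpow_pos_of_pos hj1 p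
    have h2p : (0 : ℝ) < (2 * Real.pi) ^ p := Real.rpow_pos_of_pos h2pi p
    field_simp
  -- `(j/(j+1))^p → 1`, hence eventually `> 1/R`
  have hratio : Tendsto (fun j : ℕ => ((j : ℝ) / (j + 1)) ^ p) atTop (𝓝 1) := by
    have h1 : Tendsto (fun j : ℕ => (j : ℝ) / (j + 1)) atTop (𝓝 1) := tendsto_natCast_div_add_atTop 1
    have h2 : ContinuousAt (fun x : ℝ => x ^ p) 1 :=
      Real.continuousAt_rpow_const 1 p (Or.inl one_ne_zero)
    have h3 := h2.tendsto.comp h1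
    simpa [Function.comp_def, Real.one_rpow] using h3
  have hR0 : 0 < R := lt_trans one_pos hR
  have hRinv : 1 / R < 1 := by rw [div_lt_one hR0]; exact hR
  obtain ⟨j₀', hj₀'⟩ := eventually_atTop.1 (hratio.eventually (lt_mem_nhds hRinv))
  set j₀ : ℕ := max j₀' 1 with hj₀
  have hj₀1 : 1 ≤ j₀ := le_max_right _ _
  have hrat : ∀ j, j₀ ≤ j → 1 / R < ((j : ℝ) / (j + 1)) ^ p := fun j hj =>
    hj₀' j ((le_max_left _ _).trans hj)
  -- `v j → 0`
  have hvlim : Tendsto v atTop (𝓝 0) := by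
    have h1 : Tendsto (fun j : ℕ => 2 * Real.pi * (j : ℝ)) atTop atTop :=
      tendsto_natCast_atTop_atTop.const_mul_atTop (by positivity)
    have h2 : Tendsto (fun j : ℕ => (2 * Real.pi * (j : ℝ)) ^ p) atTop atTop :=
      (tendsto_rpow_atTop hp).comp h1
    exact tendsto_const_nhds.div_atTop h2
  -- choose the level `m ≥ 1` with `R εₘ ≤ v j₀`
  have hvj₀ : 0 < v j₀ / R := div_pos (hvpos j₀ hj₀1) hR0
  obtain ⟨m₁, hm₁⟩ := eventually_atTop.1 (hε0.eventually (Iic_mem_nhds hvj₀))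
  set m : ℕ := max m₁ 1 with hm
  have hm1 : 1 ≤ m := le_max_right _ _
  have hεm : ε m ≤ v j₀ / R := hm₁ m (le_max_left _ _)
  have hεm' : R * ε m ≤ v j₀ := by
    rw [le_div_iff₀ hR0] at hεm; linarith
  -- the first admissible `j ≥ j₀` below the top of the window
  have hex : ∃ j : ℕ, j₀ ≤ j ∧ v j ≤ R * ε m := by
    have hRε : 0 < R * ε m := mul_pos hR0 (hε m)
    obtain ⟨j₁, hj₁⟩ := eventually_atTop.1 (hvlim.eventually (Iic_mem_nhds hRε))
    exact ⟨max j₁ j₀, le_max_right _ _, hj₁ _ (le_max_left _ _)⟩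
  let j := Nat.find hex
  have hjspec : j₀ ≤ j ∧ v j ≤ R * ε m := Nat.find_spec hex
  have hjmin : ∀ i, i < j → ¬ (j₀ ≤ i ∧ v i ≤ R * ε m) := fun i hi => Nat.find_min hex hi
  refine ⟨m, hm1, j, hj₀1.trans hjspec.1, ?_, hjspec.2⟩
  -- lower bound `εₘ ≤ v j`
  rcases hjspec.1.eq_or_lt with hjeq | hjlt
  · -- `j = j₀`
    rw [← hjeq]
    have : ε m ≤ R * ε m := le_mul_of_one_le_left (hε m).le hR.le
    exact this.trans hεm'
  · -- `j > j₀`: the predecessor is above the window, and one step loses at most a factor `R`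
    obtain ⟨i, hi⟩ : ∃ i, j = i + 1 := ⟨j - 1, by omega⟩
    have hi₀ : j₀ ≤ i := by omega
    have hvi : R * ε m < v i := by
      have := hjmin i (by omega)
      push Not at this
      exact this hi₀
    have hi1 : 1 ≤ i := hj₀1.trans hi₀
    show ε m ≤ v j
    rw [hi, hsucc i hi1]
    have hr := hrat i hi₀
    have hvi0 := hvpos i hi1
    calc ε m = (R * ε m) * (1 / R) := by field_simp
      _ ≤ v i * ((i : ℝ) / (i + 1)) ^ p :=
          mul_le_mul hvi.le hr.le (by positivity) hvi0.le

end Window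

/-! ## The class of Prop. 5.5 is inhabited -/

section Inhabited

/-- **`q(β) ≤ 17` for `β ≥ 68/67`** ((2.2): `q = ½(1 + (2-β)/(2(β-1)))`, decreasing in `β`, `= 17` at
`β = 68/67`). [cite: ArmstrongVicol2025, §2.1 (2.2) p. 18] -/
theorem qExp_le_seventeen {β : ℝ} (h1 : 68 / 67 ≤ β) (h2 : β < 4 / 3) : qExp β ≤ 17 := by
  unfold qExp
  have hb : 0 < 2 * (β - 1) := by linarith
  have h : (2 - β) / (2 * (β - 1)) ≤ 33 := by
    rw [div_le_iff₀ hb]; linarith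
  linarith

/-- **The exponent of Prop. 5.5 is positive**: `2 + γ - 2qδ > 0` for `β ∈ [68/67, 4/3)`, with
`q = q(β)` (2.2), `γ` (2.7), `δ` (2.5) = `(q-1)²/(4(q+1)(4q-1))` by (2.3) (p. 98: "they satisfy
`2 + γ - 2qδ > 0` for all `β ∈ (1, 4/3)`"; here `2qδ = q(q-1)²/(2(q+1)(4q-1)) < 2` on `1 < q ≤ 17` and
`γ > 0`). [cite: ArmstrongVicol2025, §5.5 p. 98; §2.1 (2.2)–(2.7) p. 18] -/
theorem selectionExponent_pos {β : ℝ} (h1 : 68 / 67 ≤ β) (h2 : β < 4 / 3) :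
    0 < selectionExponent β := by
  have hβ1 : 1 < β := by linarith
  have hq1 : 1 < qExp β := one_lt_qExp hβ1 h2
  have hq17 : qExp β ≤ 17 := qExp_le_seventeen h1 h2
  have hγ : 0 < gammaExp β (qExp β) := gammaExp_pos (by linarith) hq1
  have hδ : deltaExp β (qExp β) = (qExp β - 1) ^ 2 / (4 * (qExp β + 1) * (4 * qExp β - 1)) :=
    deltaExp_eq_sq hq1 (beta_eq_of_qExp hβ1)
  unfold selectionExponent
  refine div_pos two_pos ?_
  rw [hδ]
  set q := qExp β with hq
  have hden : 0 < 4 * (q + 1) * (4 * q - 1) := by nlinarith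
  have h2qδ : 2 * q * ((q - 1) ^ 2 / (4 * (q + 1) * (4 * q - 1))) < 2 := by
    rw [mul_div_assoc', div_lt_iff₀ hden]
    -- `-q³ + 18q² + 11q - 4 = (q-1)((17-q)q + 28) + 24 > 0` on `1 < q ≤ 17`
    have ht : 0 ≤ (q - 1) * ((17 - q) * q) :=
      mul_nonneg (sub_pos.2 hq1).le (mul_nonneg (sub_nonneg.2 hq17) (by linarith))
    nlinarith [ht]
  linarith

/-- The squared length of the axis frequency `j e_{i₀}` is `j²`. [folklore] -/
private theorem freqNormSq_single [DecidableEq d] (i₀ : d) (j : ℤ) :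
    FunctionSpaces.Torus.freqNormSq (Pi.single i₀ j : d → ℤ) = (j : ℝ) ^ 2 := by
  unfold FunctionSpaces.Torus.freqNormSq
  rw [Finset.sum_eq_single i₀]
  · rw [Pi.single_eq_same]
  · intro i _ hi
    rw [Pi.single_eq_of_ne hi]
    simp
  · intro h
    exact absurd (Finset.mem_univ i₀) h

/-- `εₘ → 0` for the printed scales (2.8) ((2.9): `εₘ ≤ Λ^{-m}`, `Λ ≥ 3`).
[cite: ArmstrongVicol2025, §2.1 (2.9) p. 19] -/
theorem tendsto_scaleSeq_zero {Λ : ℕ} {q : ℝ} (hΛ : 3 ≤ Λ) (hq : 1 < q) :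
    Tendsto (scaleSeq Λ q) atTop (𝓝 0) := by
  have hΛ0 : 0 < Λ := by omega
  have hΛr : (1 : ℝ) < Λ := by exact_mod_cast (show 1 < Λ by omega)
  have hinv0 : (0 : ℝ) ≤ (Λ : ℝ)⁻¹ := by positivity
  have hinv1 : ((Λ : ℝ)⁻¹) < 1 := inv_lt_one_of_one_lt₀ hΛr
  exact squeeze_zero (fun m => (scaleSeq_pos hΛ0 m).le) (scaleSeq_le_inv_pow hΛ hq)
    (tendsto_pow_atTop_nhds_zero_of_lt_one hinv0 hinv1)

/-- **Prop. 5.5's data class is inhabited by cosine modes.** For every `β` with `q(β) > 1` and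
positive exponent `p = 2/(2+γ-2qδ)`, every `C⋆ > 0`, `A ≤ 1`, `B > 1` and every minimal scale
separation `Λ ≥ 3`, some axis mode `cos(2π j x_{i₀})` (`j ≥ 1`) belongs to
`InSelectionClass β C⋆ A B Λ`: it is a mean-zero Laplace eigenfunction (so (5.139) holds for
`A ≤ 1`), and its length scale `L = 1/(2πj)` can be placed in a window
`ε_{m⋆} ≤ C⋆ L^p ≤ min(B,2) ε_{m⋆} < ε_{m⋆-1}` (`exists_lengthScale_window`, (2.9)).
AV p. 93: "Our result applies to a large class of `Ḣ²(T²)` initial conditions, but not to all of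
them." [cite: ArmstrongVicol2025, Prop. 5.5 p. 93; (5.139)–(5.140) p. 99; (2.9) p. 19] -/
theorem exists_inSelectionClass [DecidableEq d] (i₀ : d) {β Cstar A B : ℝ} {Λ : ℕ}
    (hq : 1 < qExp β) (hp : 0 < selectionExponent β) (hC : 0 < Cstar) (hA : A ≤ 1) (hB : 1 < B)
    (hΛ : 3 ≤ Λ) :
    ∃ j : ℕ, 1 ≤ j ∧ InSelectionClass β Cstar A B Λ
      (FunctionSpaces.Torus.reTrigPoly
        {(Pi.single i₀ (j : ℤ) : d → ℤ), -(Pi.single i₀ (j : ℤ) : d → ℤ)}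
        (fun _ => (((1 / 2 : ℝ)) : ℂ))) := by
  have hΛ0 : 0 < Λ := by omega
  -- the window
  set R : ℝ := min B 2 with hR
  have hR1 : 1 < R := lt_min hB one_lt_two
  have hRB : R ≤ B := min_le_left _ _
  have hR2 : R ≤ 2 := min_le_right _ _
  obtain ⟨m, hm1, j, hj1, hlow, hup⟩ :=
    exists_lengthScale_window hp hC hR1 (scaleSeq_pos (q := qExp β) hΛ0)
      (tendsto_scaleSeq_zero hΛ hq)
  refine ⟨j, hj1, ?_⟩
  -- the frequency
  set k : d → ℤ := Pi.single i₀ (j : ℤ) with hk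
  have hk0 : k ≠ 0 := by
    intro h
    have := congr_fun h i₀
    rw [hk, Pi.single_eq_same, Pi.zero_apply] at this
    omega
  have hn : FunctionSpaces.Torus.freqNormSq k = (j : ℝ) ^ 2 := by
    rw [hk, freqNormSq_single]; norm_cast
  -- the length scale `ℓ = 1/(2πj)` and `C⋆ ℓ^p = C⋆/(2πj)^p`
  have hj0 : (0 : ℝ) < j := by exact_mod_cast hj1
  have h2pij : (0 : ℝ) < 2 * Real.pi * j := by positivity
  set ℓ : ℝ := 1 / (2 * Real.pi * j) with hℓ
  have hℓ0 : 0 < ℓ := by positivity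
  have hℓsq : ℓ ^ 2 * (4 * Real.pi ^ 2 * FunctionSpaces.Torus.freqNormSq k) = 1 := by
    rw [hn, hℓ]
    field_simp
    ring
  have hℓp : Cstar * ℓ ^ selectionExponent β = Cstar / (2 * Real.pi * j) ^ selectionExponent β := by
    rw [hℓ, Real.div_rpow zero_le_one h2pij.le, Real.one_rpow]
    ring
  refine ⟨memSobolev_cosMode k 2, hasZeroMean_cosMode hk0, ?_, cond5139_cosMode hk0 hA,
    ℓ, hℓ0, lengthScale_cosMode hk0 hℓsq, m, hm1, ?_, ?_, ?_⟩
  · rw [scalarL2Sq_cosMode hk0]; norm_num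
  · rw [hℓp]; exact hlow
  · -- `C⋆ ℓ^p ≤ R εₘ ≤ 2 εₘ < 3 εₘ ≤ Λ εₘ ≤ ε_{m-1}`
    rw [hℓp]
    have hεm := scaleSeq_pos (q := qExp β) hΛ0 m
    have hrat := scaleSeq_ratio hΛ hq (m - 1)
    rw [show m - 1 + 1 = m by omega] at hrat
    have hΛ3 : (3 : ℝ) ≤ Λ := by exact_mod_cast hΛ
    calc Cstar / (2 * Real.pi * j) ^ selectionExponent β ≤ R * scaleSeq Λ (qExp β) m := hup
      _ < (Λ : ℝ) * scaleSeq Λ (qExp β) m := by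
          apply mul_lt_mul_of_pos_right _ hεm
          linarith
      _ ≤ scaleSeq Λ (qExp β) (m - 1) := hrat
  · rw [hℓp]
    exact hup.trans (mul_le_mul_of_nonneg_right hRB (scaleSeq_pos (q := qExp β) hΛ0 m).le)

/-- **Prop. 5.5 is not vacuous: the Armstrong–Vicol carrier admits an explicit datum without
selection.** From `ArmstrongVicol2025_prop55`: for every `β ∈ [68/67, 4/3)` there are a velocity field
`u` on `ℝ × T²` in the carrier class of Thm. 1.1 (`IsCarrier (β-1)`), dissipating all mean-zero `H¹`
data anomalously along its intervals (`DissipatesAlongIntervals`), and a smooth mean-zero nonzero datum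
`θ₀` (a cosine mode `cos(2πj x₁)`) with `LacksSelectionAt u θ₀` — two null sequences of
diffusivities along which the solutions converge in `C^{0,μ}([0,1];L²(T²))` to two distinct weak
solutions of the transport equation. (Parameters: the `C⋆(β)` of the fact, `A = 1`, `B = 2`,
`Λ = max(Λ₀, 3)`; the datum from `exists_inSelectionClass`.)
[cite: ArmstrongVicol2025, Prop. 5.5 p. 93 with (5.139)–(5.140) p. 99] -/
theorem exists_lacksSelectionAt_of_prop55 (h : ArmstrongVicol2025_prop55) {β : ℝ}
    (h1 : 68 / 67 ≤ β) (h2 : β < 4 / 3) :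
    ∃ (u : ℝ → UnitAddTorus (Fin 2) → EuclideanSpace ℝ (Fin 2)) (θ₀ : UnitAddTorus (Fin 2) → ℝ),
      IsCarrier (β - 1).toNNReal u ∧ (∃ κ : ℕ → ℝ, DissipatesAlongIntervals u κ) ∧
      FunctionSpaces.Torus.IsSmooth θ₀ ∧ FunctionSpaces.Torus.HasZeroMean θ₀ ∧
      0 < Torus.scalarL2Sq θ₀ ∧ LacksSelectionAt u θ₀ := by
  have hβ1 : 1 < β := by linarith
  obtain ⟨Cstar, hC1, hrest⟩ := h β h1 h2
  obtain ⟨Λ₀, hΛ₀⟩ := hrest 1 one_pos le_rfl 2 one_lt_two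
  obtain ⟨u, hu, hdiss, hclass⟩ := hΛ₀ (max Λ₀ 3) (le_max_left _ _)
  obtain ⟨j, hj1, hθ⟩ := exists_inSelectionClass (d := Fin 2) 0 (one_lt_qExp hβ1 h2)
    (selectionExponent_pos h1 h2) (lt_of_lt_of_le one_pos hC1) le_rfl one_lt_two (le_max_right _ _)
  have hk0 : (Pi.single (0 : Fin 2) (j : ℤ) : Fin 2 → ℤ) ≠ 0 := by
    intro h0
    have := congr_fun h0 0
    rw [Pi.single_eq_same, Pi.zero_apply] at this
    omega
  exact ⟨u, _, hu, hdiss, isSmooth_cosMode _, hasZeroMean_cosMode hk0,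
    by rw [scalarL2Sq_cosMode hk0]; norm_num, hclass _ hθ⟩

end Inhabited

end ArmstrongVicol2025

end

end Literature.Analysis.FluidPDE
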